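import Literature.NumberTheory.Sieve.BatemanHornProofs
import Literature.NumberTheory.Sieve.AletheiaZomleferFukshanskyGarcia2020ApplicationsBrunSieveProofs
import Literature.NumberTheory.LFunctions.MertensConstant
import Literature.NumberTheory.Sieve.SmoothMajorantLocal
import HarnessLib

/-!
# Mertens' theorem for the sieve product of a Bateman–Horn system

Topic `Literature/NumberTheory/Sieve`, companion of `BatemanHorn.lean` / `BatemanHornProofs.lean`
(the Bateman–Horn constant `C(f)` of a system `f = (f₁, …, f_k)` of integer polynomials and the
PROVED convergence `∏_{p ≤ y} (1 - 1/p)^{-k}(1 - ω_f(p)/p) → C(f) > 0`,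
`IsBatemanHornSystem.hasBatemanHornConst_holds`) and of Mertens' third theorem
`Literature.NumberTheory.LFunctions.Mertens.tendsto_log_mul_prod_one_sub_inv_nat`.  Everything here
is PROVED and elementary; no definition and no named fact is introduced (sub-namespace
`BatemanHornMertens`).

* `tendsto_log_pow_mul_prod_one_sub_rootCount` — **Mertens' theorem along a Bateman–Horn system**:
  `(log n)^k · ∏_{p ≤ n} (1 − ω_f(p)/p) → C(f)·e^{−kγ}`, and the single-polynomial case
  `tendsto_log_mul_prod_one_sub_rootCount_single`.
* `isBatemanHornSystem_single` — every member `![fᵢ]` of a Bateman–Horn system is itself a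
  Bateman–Horn system (`ρᵢ(p) ≤ ω_f(p) < p`), with `ρᵢ(p) ≤ deg fᵢ`
  (`rootCount_single_le_natDegree`).
* `card_filter_exists_dvd_eval`, `card_filter_exists_and_dvd_eval_eq_sum` — the class counts
  `#{r mod p : ∃ i ∈ T, p ∣ fᵢ(r)}`: equal to `ω_f(p)` when `T` is everything, and to
  `∑_{i ∈ T} ρᵢ(p)` as soon as `ω_f(p) = ∑ᵢ ρᵢ(p)` (all large `p`,
  `IsBatemanHornSystem.exists_polyRootCountMod_eq_sum`).
* `prod_one_sub_le`, `one_sub_div_prod_bounds` — Weierstrass' product inequalities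
  `1 − s ≤ ∏(1 − aᵢ) ≤ 1 − s + s²` (`s = ∑ aᵢ`, `aᵢ ∈ [0,1]`; the lower bound is the tree's
  `CFZ.one_sub_sum_le_prod_one_sub`) and the consequence `0 ≤ 1 − (1 − s)/∏(1 − aᵢ) ≤ 2s²`,
  which controls replacing `1 − ∑ρᵢ/p` by `∏(1 − ρᵢ/p)` prime by prime.
* `mem_primesLE_ceil_sub_one`, `tendsto_ceil_rpow_sub_one_atTop`,
  `tendsto_log_ceil_rpow_sub_one_div_log` — the threshold `m = ⌈x^c⌉₊ − 1` (the primes `p ≤ m` are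
  exactly the primes `p < x^c`) and `log m / log x → c`.
* `tendsto_log_pow_mul_comp`, `tendsto_div_comp_of_log_mul` — transporting a Mertens-type limit
  `(log n)^k ψ(n) → L` to thresholds `n = m(x)` with `log m(x)/log x → c`.

## References

* P. T. Bateman, R. A. Horn, Math. Comp. 16 (1962), 363–367, §2.
* G. H. Hardy, E. M. Wright, *An Introduction to the Theory of Numbers*, Thm 429 (Mertens).
-/

noncomputable section

open Filter Finset Polynomial
open scoped Topology

namespace Literature.NumberTheory.Sieve

namespace BatemanHornMertens

/-! ### Weierstrass' product inequalities

The lower bound `1 − ∑ aᵢ ≤ ∏ (1 − aᵢ)` is the tree's `CFZ.one_sub_sum_le_prod_one_sub`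
(`SmoothMajorantLocal.lean`); we add the companion upper bound. -/

/-- The companion upper bound `∏ (1 − aᵢ) ≤ 1 − ∑ aᵢ + (∑ aᵢ)²` for `aᵢ ∈ [0,1]`. [folklore] -/
theorem prod_one_sub_le {α : Type*} (t : Finset α) {a : α → ℝ}
    (h0 : ∀ i ∈ t, 0 ≤ a i) (h1 : ∀ i ∈ t, a i ≤ 1) :
    ∏ i ∈ t, (1 - a i) ≤ 1 - ∑ i ∈ t, a i + (∑ i ∈ t, a i) ^ 2 := by
  classical
  induction t using Finset.induction_on with
  | empty => simp
  | insert j t hj ih =>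
    rw [sum_insert hj, prod_insert hj]
    have ih' := ih (fun i hi => h0 i (mem_insert_of_mem hi)) fun i hi => h1 i (mem_insert_of_mem hi)
    have hj0 := h0 j (mem_insert_self j t)
    have hj1 := h1 j (mem_insert_self j t)
    have hs0 : 0 ≤ ∑ i ∈ t, a i := sum_nonneg fun i hi => h0 i (mem_insert_of_mem hi)
    calc (1 - a j) * ∏ i ∈ t, (1 - a i)
        ≤ (1 - a j) * (1 - ∑ i ∈ t, a i + (∑ i ∈ t, a i) ^ 2) :=
          mul_le_mul_of_nonneg_left ih' (sub_nonneg.mpr hj1)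
      _ ≤ 1 - (a j + ∑ i ∈ t, a i) + (a j + ∑ i ∈ t, a i) ^ 2 := by
          nlinarith [mul_nonneg hj0 hs0, sq_nonneg (a j), mul_nonneg hj0 (sq_nonneg (∑ i ∈ t, a i))]

/-- For `aᵢ ∈ [0,1)` with `s = ∑ aᵢ ≤ 1`: `0 ≤ 1 − (1 − s)/∏(1 − aᵢ) ≤ 2 s²`. [folklore] -/
theorem one_sub_div_prod_bounds {α : Type*} (t : Finset α) {a : α → ℝ}
    (h0 : ∀ i ∈ t, 0 ≤ a i) (h1 : ∀ i ∈ t, a i < 1) (hs : ∑ i ∈ t, a i ≤ 1) :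
    0 ≤ 1 - (1 - ∑ i ∈ t, a i) / ∏ i ∈ t, (1 - a i) ∧
      1 - (1 - ∑ i ∈ t, a i) / ∏ i ∈ t, (1 - a i) ≤ 2 * (∑ i ∈ t, a i) ^ 2 := by
  have hP : 0 < ∏ i ∈ t, (1 - a i) := prod_pos fun i hi => sub_pos.mpr (h1 i hi)
  have h1' : ∀ i ∈ t, a i ≤ 1 := fun i hi => (h1 i hi).le
  have hlo := CFZ.one_sub_sum_le_prod_one_sub t h0 h1'
  have hhi := prod_one_sub_le t h0 h1'
  refine ⟨by rw [sub_nonneg, div_le_one hP]; exact hlo, ?_⟩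
  have hq : 0 < 1 - ∑ i ∈ t, a i + (∑ i ∈ t, a i) ^ 2 := by
    nlinarith [sq_nonneg (∑ i ∈ t, a i - 1 / 2)]
  have h2 : (1 - ∑ i ∈ t, a i) / (1 - ∑ i ∈ t, a i + (∑ i ∈ t, a i) ^ 2) ≤
      (1 - ∑ i ∈ t, a i) / ∏ i ∈ t, (1 - a i) :=
    div_le_div_of_nonneg_left (sub_nonneg.mpr hs) hP hhi
  have h3 : 1 - 2 * (∑ i ∈ t, a i) ^ 2 ≤
      (1 - ∑ i ∈ t, a i) / (1 - ∑ i ∈ t, a i + (∑ i ∈ t, a i) ^ 2) := by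
    rw [le_div_iff₀ hq]
    nlinarith [sq_nonneg ((∑ i ∈ t, a i) * (1 - ∑ i ∈ t, a i)), sq_nonneg ((∑ i ∈ t, a i) ^ 2)]
  linarith

/-! ### Single members of a Bateman–Horn system -/

variable {ι : Type*} [Fintype ι]

/-- A root of `fᵢ` modulo `p` is a root of `∏ⱼ fⱼ`: `ρᵢ(p) ≤ ω_f(p)`. [folklore] -/
theorem polyRootCountMod_single_le (f : ι → ℤ[X]) (i : ι) (p : ℕ) :
    polyRootCountMod ![f i] p ≤ polyRootCountMod f p := by
  rw [polyRootCountMod_single]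
  unfold polyRootCountMod
  refine card_le_card fun n hn => ?_
  rw [mem_filter] at hn ⊢
  exact ⟨hn.1, hn.2.trans (Finset.dvd_prod_of_mem (fun j => (f j).eval (n : ℤ)) (mem_univ i))⟩

/-- Every member `![fᵢ]` of a Bateman–Horn system is a Bateman–Horn system (irreducible, positive
leading coefficient, and `ρᵢ(p) ≤ ω_f(p) < p`). [folklore] -/
theorem isBatemanHornSystem_single {f : ι → ℤ[X]} (hf : IsBatemanHornSystem f) (i : ι) :
    IsBatemanHornSystem ![f i] where
  irreducible j := by simpa using hf.irreducible i
  leadingCoeff_pos j := by simpa using hf.leadingCoeff_pos i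
  pairwise_not_associated := Subsingleton.pairwise
  hasNoFixedPrimeDivisor p hp :=
    (polyRootCountMod_single_le f i p).trans_lt (hf.hasNoFixedPrimeDivisor p hp)

/-- In a Bateman–Horn system, `ρᵢ(p) < p` for every prime `p`. [folklore] -/
theorem rootCount_single_lt {f : ι → ℤ[X]} (hf : IsBatemanHornSystem f) (i : ι) {p : ℕ}
    (hp : p.Prime) : polyRootCountMod ![f i] p < p :=
  (polyRootCountMod_single_le f i p).trans_lt (hf.hasNoFixedPrimeDivisor p hp)

/-- In a Bateman–Horn system, `ρᵢ(p) ≤ deg fᵢ` for every prime `p` (Lagrange). [folklore] -/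
theorem rootCount_single_le_natDegree {f : ι → ℤ[X]} (hf : IsBatemanHornSystem f) (i : ι)
    {p : ℕ} (hp : p.Prime) : polyRootCountMod ![f i] p ≤ (f i).natDegree :=
  PolyPrimeCountBrun.polyRootCountMod_single_le_natDegree_of_lt hp (rootCount_single_lt hf i hp)

/-! ### Class counts `#{r mod p : ∃ i ∈ T, p ∣ fᵢ(r)}`

These are stated for families indexed by `Fin k` (as in the applications), so that the decidability
instance of `∃ i, …` inside `Finset.filter` is the one found for `Fin k`
(`Nat.decidableExistsFin`). -/

/-- For a prime `p`, `#{r mod p : ∃ i, p ∣ fᵢ(r)} = ω_f(p)`. [folklore] -/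
theorem card_filter_exists_dvd_eval {k : ℕ} (f : Fin k → ℤ[X]) {p : ℕ} (hp : p.Prime) :
    #((range p).filter fun r : ℕ => ∃ i, (p : ℤ) ∣ (f i).eval (r : ℤ)) =
      polyRootCountMod f p := by
  unfold polyRootCountMod
  congr 1
  refine filter_congr fun r _ => ?_
  rw [(Nat.prime_iff_prime_int.mp hp).dvd_finsetProd_iff]
  simp

/-- For a prime `p` and an everywhere-true side condition `T`,
`#{r mod p : ∃ i, T i ∧ p ∣ fᵢ(r)} = ω_f(p)`. [folklore] -/
theorem card_filter_exists_and_dvd_eval_of_forall {k : ℕ} (f : Fin k → ℤ[X]) {p : ℕ}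
    (hp : p.Prime) (T : Fin k → Prop) [DecidablePred T] (hT : ∀ i, T i) :
    #((range p).filter fun r : ℕ => ∃ i, T i ∧ (p : ℤ) ∣ (f i).eval (r : ℤ)) =
      polyRootCountMod f p := by
  rw [← card_filter_exists_dvd_eval f hp]
  congr 1
  exact filter_congr fun r _ => by simp [hT]

/-- If `ω_f(p) = ∑ᵢ ρᵢ(p)` (true for all large primes `p`,
`IsBatemanHornSystem.exists_polyRootCountMod_eq_sum`), then for every sub-collection `T`,
`#{r mod p : ∃ i ∈ T, p ∣ fᵢ(r)} = ∑_{i ∈ T} ρᵢ(p)` (union bound for `T`, and for the complement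
inside the full count). [folklore] -/
theorem card_filter_exists_and_dvd_eval_eq_sum {k : ℕ} (f : Fin k → ℤ[X]) {p : ℕ}
    (hp : p.Prime) (hsum : polyRootCountMod f p = ∑ i, polyRootCountMod ![f i] p)
    (T : Fin k → Prop) [DecidablePred T] :
    #((range p).filter fun r : ℕ => ∃ i, T i ∧ (p : ℤ) ∣ (f i).eval (r : ℤ)) =
      ∑ i ∈ univ.filter T, polyRootCountMod ![f i] p := by
  have hρ : ∀ i, polyRootCountMod ![f i] p =
      #((range p).filter fun r : ℕ => (p : ℤ) ∣ (f i).eval (r : ℤ)) :=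
    fun i => polyRootCountMod_single _ _
  have hup : #((range p).filter fun r : ℕ => ∃ i, T i ∧ (p : ℤ) ∣ (f i).eval (r : ℤ)) ≤
      ∑ i ∈ univ.filter T, #((range p).filter fun r : ℕ => (p : ℤ) ∣ (f i).eval (r : ℤ)) := by
    refine le_trans (card_le_card ?_) card_biUnion_le
    intro r hr
    rw [mem_filter] at hr
    obtain ⟨hr, i, hi, hdvd⟩ := hr
    exact mem_biUnion.mpr ⟨i, mem_filter.mpr ⟨mem_univ _, hi⟩, mem_filter.mpr ⟨hr, hdvd⟩⟩
  have hfull : polyRootCountMod f p ≤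
      #((range p).filter fun r : ℕ => ∃ i, T i ∧ (p : ℤ) ∣ (f i).eval (r : ℤ)) +
        ∑ i ∈ univ.filter (fun i => ¬ T i),
          #((range p).filter fun r : ℕ => (p : ℤ) ∣ (f i).eval (r : ℤ)) := by
    rw [← card_filter_exists_dvd_eval f hp]
    refine le_trans (card_le_card ?_)
      (le_trans (card_union_le _ _) (Nat.add_le_add_left card_biUnion_le _))
    intro r hr
    rw [mem_filter] at hr
    obtain ⟨hr, i, hdvd⟩ := hr
    rw [mem_union, mem_biUnion]
    by_cases hi : T i
    · exact Or.inl (mem_filter.mpr ⟨hr, i, hi, hdvd⟩)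
    · exact Or.inr ⟨i, mem_filter.mpr ⟨mem_univ _, hi⟩, mem_filter.mpr ⟨hr, hdvd⟩⟩
  have hsplit : ∑ i ∈ univ.filter T, #((range p).filter fun r : ℕ => (p : ℤ) ∣ (f i).eval (r : ℤ)) +
      ∑ i ∈ univ.filter (fun i => ¬ T i),
        #((range p).filter fun r : ℕ => (p : ℤ) ∣ (f i).eval (r : ℤ)) =
      ∑ i, #((range p).filter fun r : ℕ => (p : ℤ) ∣ (f i).eval (r : ℤ)) :=
    sum_filter_add_sum_filter_not _ _ _
  simp only [hρ] at hsum ⊢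
  omega

/-! ### Mertens' theorem along a Bateman–Horn system -/

/-- **Mertens' theorem along a Bateman–Horn system**: `(log n)^k ∏_{p ≤ n} (1 − ω_f(p)/p) →
C(f) e^{−kγ}` — the sieve product is the Bateman–Horn partial product (`→ C(f)`,
`IsBatemanHornSystem.hasBatemanHornConst_holds`) times the `k`-th power of Mertens' product
(`log n ∏_{p ≤ n}(1 − 1/p) → e^{−γ}`). [folklore] -/
theorem tendsto_log_pow_mul_prod_one_sub_rootCount {k : ℕ} {f : Fin k → ℤ[X]}
    (hf : IsBatemanHornSystem f) :
    Tendsto (fun n : ℕ => Real.log n ^ k *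
        ∏ p ∈ Nat.primesLE n, (1 - (polyRootCountMod f p : ℝ) / p)) atTop
      (𝓝 (batemanHornConst f * Real.exp (-((k : ℝ) * Real.eulerMascheroniConstant)))) := by
  have h1 : Tendsto (batemanHornPartial f) atTop (𝓝 (batemanHornConst f)) :=
    (IsBatemanHornSystem.hasBatemanHornConst_holds hf).1
  have h2 :=
    (Literature.NumberTheory.LFunctions.Mertens.tendsto_log_mul_prod_one_sub_inv_nat).pow k
  have h := h1.mul h2
  rw [← Real.exp_nat_mul, mul_neg] at h
  refine h.congr fun n => ?_
  rw [PolyPrimeCountBrun.prod_one_sub_rootCount_eq, mul_pow]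
  simp_rw [one_div]
  ring

/-- Mertens' theorem for a single polynomial forming a Bateman–Horn system:
`log n ∏_{p ≤ n} (1 − ρ_g(p)/p) → C(g) e^{−γ}`. [folklore] -/
theorem tendsto_log_mul_prod_one_sub_rootCount_single {g : ℤ[X]}
    (hg : IsBatemanHornSystem ![g]) :
    Tendsto (fun n : ℕ => Real.log n *
        ∏ p ∈ Nat.primesLE n, (1 - (polyRootCountMod ![g] p : ℝ) / p)) atTop
      (𝓝 (batemanHornConst ![g] * Real.exp (-Real.eulerMascheroniConstant))) := by
  simpa using tendsto_log_pow_mul_prod_one_sub_rootCount hg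

/-! ### Thresholds `⌈x^c⌉₊ − 1` -/

/-- The primes `p ≤ ⌈z⌉₊ − 1` are exactly the primes `p < z`. [folklore] -/
theorem mem_primesLE_ceil_sub_one {z : ℝ} {p : ℕ} :
    p ∈ Nat.primesLE (⌈z⌉₊ - 1) ↔ p.Prime ∧ (p : ℝ) < z := by
  rw [Nat.mem_primesLE]
  constructor
  · rintro ⟨h1, h2⟩
    refine ⟨h2, Nat.lt_ceil.mp ?_⟩
    have := h2.two_le
    omega
  · rintro ⟨h1, h2⟩
    have := Nat.lt_ceil.mpr h2
    exact ⟨by omega, h1⟩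

/-- `⌈x^c⌉₊ − 1 → ∞` along `x : ℕ`, for `c > 0`. [folklore] -/
theorem tendsto_ceil_rpow_sub_one_atTop {c : ℝ} (hc : 0 < c) :
    Tendsto (fun x : ℕ => ⌈(x : ℝ) ^ c⌉₊ - 1) atTop atTop :=
  (tendsto_sub_atTop_nat 1).comp <| tendsto_nat_ceil_atTop.comp <|
    (tendsto_rpow_atTop hc).comp tendsto_natCast_atTop_atTop

/-- `log (⌈x^c⌉₊ − 1) / log x → c` along `x : ℕ`, for `c > 0`. [folklore] -/
theorem tendsto_log_ceil_rpow_sub_one_div_log {c : ℝ} (hc : 0 < c) :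
    Tendsto (fun x : ℕ => Real.log ((⌈(x : ℝ) ^ c⌉₊ - 1 : ℕ) : ℝ) / Real.log x) atTop (𝓝 c) := by
  have hlog : Tendsto (fun x : ℕ => Real.log x) atTop atTop :=
    Real.tendsto_log_atTop.comp tendsto_natCast_atTop_atTop
  have hlow : Tendsto (fun x : ℕ => c - Real.log 2 / Real.log x) atTop (𝓝 c) := by
    simpa using tendsto_const_nhds.sub (tendsto_const_nhds.div_atTop hlog)
  have hy : ∀ᶠ x : ℕ in atTop, (2 : ℝ) ≤ (x : ℝ) ^ c :=
    ((tendsto_rpow_atTop hc).comp tendsto_natCast_atTop_atTop).eventually (eventually_ge_atTop 2)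
  have hx2 : ∀ᶠ x : ℕ in atTop, 2 ≤ x := eventually_ge_atTop 2
  -- the basic estimates, for `x ≥ 2` and `x ^ c ≥ 2`
  have key : ∀ x : ℕ, 2 ≤ x → (2 : ℝ) ≤ (x : ℝ) ^ c →
      0 < Real.log x ∧ 0 < ((⌈(x : ℝ) ^ c⌉₊ - 1 : ℕ) : ℝ) ∧
        (x : ℝ) ^ c / 2 ≤ ((⌈(x : ℝ) ^ c⌉₊ - 1 : ℕ) : ℝ) ∧
        ((⌈(x : ℝ) ^ c⌉₊ - 1 : ℕ) : ℝ) ≤ (x : ℝ) ^ c := by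
    intro x hx hy
    have hlx : 0 < Real.log x := Real.log_pos (by exact_mod_cast hx)
    have hn1 : 1 ≤ ⌈(x : ℝ) ^ c⌉₊ := Nat.one_le_ceil_iff.mpr (by linarith)
    have hm : ((⌈(x : ℝ) ^ c⌉₊ - 1 : ℕ) : ℝ) = (⌈(x : ℝ) ^ c⌉₊ : ℝ) - 1 := by
      rw [Nat.cast_sub hn1, Nat.cast_one]
    have hle := Nat.le_ceil ((x : ℝ) ^ c)
    have hlt := Nat.ceil_lt_add_one (show (0 : ℝ) ≤ (x : ℝ) ^ c by positivity)
    refine ⟨hlx, ?_, ?_, ?_⟩ <;> rw [hm] <;> linarith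
  refine tendsto_of_tendsto_of_tendsto_of_le_of_le' hlow tendsto_const_nhds ?_ ?_
  · filter_upwards [hy, hx2] with x hy hx
    obtain ⟨hlx, hmpos, hmlow, -⟩ := key x hx hy
    have hx0 : (0 : ℝ) < x := by positivity
    rw [le_div_iff₀ hlx, sub_mul, div_mul_cancel₀ _ hlx.ne', ← Real.log_rpow hx0,
      ← Real.log_div (by positivity) two_ne_zero]
    exact Real.log_le_log (by positivity) hmlow
  · filter_upwards [hy, hx2] with x hy hx
    obtain ⟨hlx, hmpos, -, hmle⟩ := key x hx hy
    have hx0 : (0 : ℝ) < x := by positivity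
    rw [div_le_iff₀ hlx, ← Real.log_rpow hx0]
    exact Real.log_le_log hmpos hmle

/-! ### Transport of Mertens-type limits to thresholds -/

/-- If `(log n)^k ψ(n) → L`, `m(x) → ∞` and `log m(x)/log x → c > 0`, then
`(log x)^k ψ(m(x)) → L c^{−k}`. [folklore] -/
theorem tendsto_log_pow_mul_comp {ψ : ℕ → ℝ} {L c : ℝ} (k : ℕ) (hc : 0 < c)
    (hψ : Tendsto (fun n : ℕ => Real.log n ^ k * ψ n) atTop (𝓝 L))
    {m : ℕ → ℕ} (hm : Tendsto m atTop atTop)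
    (hl : Tendsto (fun x : ℕ => Real.log (m x) / Real.log x) atTop (𝓝 c)) :
    Tendsto (fun x : ℕ => Real.log x ^ k * ψ (m x)) atTop (𝓝 (L * c⁻¹ ^ k)) := by
  have h1 : Tendsto (fun x : ℕ => Real.log (m x) ^ k * ψ (m x)) atTop (𝓝 L) := hψ.comp hm
  have h2 := (hl.inv₀ hc.ne').pow k
  refine (h1.mul h2).congr' ?_
  filter_upwards [hl.eventually (lt_mem_nhds hc)] with x hx
  have hlx : Real.log x ≠ 0 := by
    intro h0
    rw [h0, div_zero] at hx
    exact lt_irrefl _ hx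
  have hlm : Real.log (m x) ≠ 0 := by
    intro h0
    rw [h0, zero_div] at hx
    exact lt_irrefl _ hx
  rw [inv_div, div_pow]
  field_simp

/-- If `log n · φ(n) → L ≠ 0`, `mⱼ(x) → ∞` and `log mⱼ(x)/log x → cⱼ` (`j = 1, 2`, `c₁ > 0`),
then `φ(m₁(x))/φ(m₂(x)) → c₂/c₁`. [folklore] -/
theorem tendsto_div_comp_of_log_mul {φ : ℕ → ℝ} {L c₁ c₂ : ℝ} (hL : L ≠ 0) (hc₁ : 0 < c₁)
    (hφ : Tendsto (fun n : ℕ => Real.log n * φ n) atTop (𝓝 L))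
    {m₁ m₂ : ℕ → ℕ} (hm₁ : Tendsto m₁ atTop atTop) (hm₂ : Tendsto m₂ atTop atTop)
    (hl₁ : Tendsto (fun x : ℕ => Real.log (m₁ x) / Real.log x) atTop (𝓝 c₁))
    (hl₂ : Tendsto (fun x : ℕ => Real.log (m₂ x) / Real.log x) atTop (𝓝 c₂)) :
    Tendsto (fun x : ℕ => φ (m₁ x) / φ (m₂ x)) atTop (𝓝 (c₂ / c₁)) := by
  have h1 : Tendsto (fun x : ℕ => Real.log (m₁ x) * φ (m₁ x)) atTop (𝓝 L) := hφ.comp hm₁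
  have h2 : Tendsto (fun x : ℕ => Real.log (m₂ x) * φ (m₂ x)) atTop (𝓝 L) := hφ.comp hm₂
  have h := (h1.div h2 hL).mul (hl₂.div hl₁ hc₁.ne')
  rw [div_self hL, one_mul] at h
  refine h.congr' ?_
  filter_upwards [hl₁.eventually (lt_mem_nhds hc₁), h2.eventually (eventually_ne_nhds hL)]
    with x hx₁ hne
  have hlx : Real.log x ≠ 0 := by
    intro h0
    rw [h0, div_zero] at hx₁
    exact lt_irrefl _ hx₁
  have hl1 : Real.log (m₁ x) ≠ 0 := by
    intro h0
    rw [h0, zero_div] at hx₁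
    exact lt_irrefl _ hx₁
  have hl2 : Real.log (m₂ x) ≠ 0 := (mul_ne_zero_iff.mp hne).1
  have hφ2 : φ (m₂ x) ≠ 0 := (mul_ne_zero_iff.mp hne).2
  simp only [Pi.div_apply]
  field_simp

end BatemanHornMertens

end Literature.NumberTheory.Sieve

end
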